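/-
Copyright (c) 2026. All rights reserved.
Released under Apache 2.0 license as described in the file LICENSE.
Authors: abc-iut cell, discharge seat abc-iut-L4-t8 (wave 2).
-/
import Mathlib.Analysis.SpecialFunctions.Complex.Log
import Mathlib.MeasureTheory.Measure.Haar.Unique
import Literature.AnabelianGeometry.AbsoluteAnabelian.LocalVolumesArchimedean
import HarnessLib

/-!
# [AbsTopIII] Proposition 5.7 (ii)(c): proof of the named fact of `LocalVolumesArchimedean.lean`

S. Mochizuki, *Topics in absolute anabelian geometry III*, J. Math. Sci. Univ. Tokyo 22 (2015)
[MochizukiAbsTopIII2015], Prop. 5.7 (ii), author's manuscript (lit key `paper:url-5493eb38cbb7`) p. 138.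

PROOF-ONLY companion of `Literature/AnabelianGeometry/AbsoluteAnabelian/LocalVolumesArchimedean.lean`
(statement file, seat abc-iut-L4-t3, p403789): it DISCHARGES the named fact
`ComplexVolume.ExpLogVolumeCompatible` — Prop. 5.7 (ii)(c) "log-compatibility" for a complex archimedean
field `k` (modelled by `ℂ`): if `A ∈ M(k)` satisfies `exp_k(A) ⊆ 𝒪_k^×` and `pr_ℝ`, `exp_k` are injective
on `A`, then `μ_k^log(A) = μ̆_k^log(exp_k(A))` (`ExpLogVolumeCompatible_holds`).

The proof is the exercise the statement file announces: `exp_k(A) ⊆ 𝒪_k^× = S¹` forces `A ⊆ iℝ`, say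
`A = i·T` with `T ⊆ ℝ` compact; then `pr_ℝ(A) = {|t| : t ∈ T}` has Lebesgue measure `λ(T)` because
`t ↦ |t|` is injective on `T` (`volume_image_abs_of_injOn`: split `T` at `0` and reflect the negative
part), while the projection of `exp_k(A) = {e^{it}}` to `𝒪_k^× = ℝ/2πℤ` is the image of `T` under
`ℝ → ℝ/2πℤ`, of Haar measure (total mass `2π`) again `λ(T)` because that map is injective on `T`
(`volume_image_coe_addCircle_of_injOn`: the preimage of the image is the disjoint union of the
translates of `T` by the periods, and `(0, 2π]` is a fundamental domain — Mathlib's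
`AddCircle.add_projection_respects_measure` and `IsAddFundamentalDomain.measure_eq_tsum`).

No new definitions; nothing here concerns any disputed claim (Prop. 5.7 is classical measure theory).
-/

set_option autoImplicit false

noncomputable section

open MeasureTheory MeasureTheory.Measure Set Metric
open scoped Pointwise NNReal ENNReal Real

namespace Literature.AnabelianGeometry.AbsoluteAnabelian

namespace ComplexVolume

/-! ## Two measure-theoretic lemmas on `ℝ` and `ℝ/pℤ` -/

/-- If `t ↦ |t|` is injective on a measurable `T ⊆ ℝ`, then `λ({|t| : t ∈ T}) = λ(T)` (split `T` at `0`;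
Lebesgue measure is reflection invariant). The radial half of the computation behind Prop. 5.7 (ii)(c).
[cite: MochizukiAbsTopIII2015, Prop 5.7 (ii)(c) p. 138] -/
theorem volume_image_abs_of_injOn {T : Set ℝ} (hT : MeasurableSet T)
    (hinj : InjOn (fun t : ℝ => |t|) T) :
    volume ((fun t : ℝ => |t|) '' T) = volume T := by
  have hsplit : (fun t : ℝ => |t|) '' T = (T ∩ Ici 0) ∪ -(T ∩ Iio 0) := by
    ext y
    simp only [mem_image, mem_union, mem_inter_iff, mem_Ici, mem_Iio, Set.mem_neg]
    constructor
    · rintro ⟨t, ht, rfl⟩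
      rcases le_or_gt 0 t with h | h
      · exact Or.inl ⟨by rwa [abs_of_nonneg h], abs_nonneg t⟩
      · refine Or.inr ⟨by rwa [abs_of_neg h, neg_neg], ?_⟩
        rw [abs_of_neg h, neg_neg]; exact h
    · rintro (⟨hy, hy0⟩ | ⟨hy, hy0⟩)
      · exact ⟨y, hy, abs_of_nonneg hy0⟩
      · exact ⟨-y, hy, by rw [abs_of_neg hy0, neg_neg]⟩
  have hdisj : Disjoint (T ∩ Ici 0) (-(T ∩ Iio 0)) := by
    refine Set.disjoint_left.mpr ?_
    rintro y ⟨hy, hy0⟩ ⟨hy', hy0'⟩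
    have h : y = -y := hinj hy hy' (by simp only [abs_neg])
    have hy00 : y = 0 := by linarith
    rw [hy00, neg_zero] at hy0'
    exact (lt_irrefl _ (mem_Iio.mp hy0')).elim
  have hdisj' : Disjoint (T ∩ Ici 0) (T ∩ Iio 0) :=
    Set.disjoint_left.mpr fun y ⟨_, hy0⟩ ⟨_, hy0'⟩ => (not_lt.mpr (mem_Ici.mp hy0)) (mem_Iio.mp hy0')
  have hunion : T ∩ Ici 0 ∪ T ∩ Iio 0 = T := by
    rw [← inter_union_distrib_left, Ici_union_Iio, inter_univ]
  rw [hsplit, measure_union hdisj (hT.inter measurableSet_Iio).neg, Measure.measure_neg,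
    ← measure_union hdisj' (hT.inter measurableSet_Iio), hunion]

/-- If the quotient map `ℝ → ℝ/pℤ` is injective on a compact `T ⊆ ℝ`, then the Haar measure (total mass `p`)
of the image of `T` equals `λ(T)`: the preimage of the image is the disjoint union of the translates
`g + T`, `g ∈ pℤ`, and `(0, p]` is a fundamental domain. The angular half of the computation behind
Prop. 5.7 (ii)(c). [cite: MochizukiAbsTopIII2015, Prop 5.7 (ii)(c) p. 138] -/
theorem volume_image_coe_addCircle_of_injOn {p : ℝ} [hp : Fact (0 < p)] {T : Set ℝ}
    (hTc : IsCompact T) (hinj : InjOn ((↑) : ℝ → AddCircle p) T) :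
    volume (((↑) : ℝ → AddCircle p) '' T) = volume T := by
  have hTm : MeasurableSet T := hTc.isClosed.measurableSet
  have hUm : MeasurableSet (((↑) : ℝ → AddCircle p) '' T) :=
    (hTc.image (AddCircle.continuous_mk' p)).isClosed.measurableSet
  -- the preimage of the image is the union of the translates of `T` by the periods
  have hpre : ((↑) : ℝ → AddCircle p) ⁻¹' (((↑) : ℝ → AddCircle p) '' T) =
      ⋃ g : AddSubgroup.zmultiples p, g +ᵥ T := by
    ext x
    simp only [mem_preimage, mem_image, mem_iUnion]
    constructor
    · rintro ⟨t, ht, htx⟩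
      have hmem : x - t ∈ AddSubgroup.zmultiples p := by
        rw [← neg_sub]; exact AddSubgroup.neg_mem _ (QuotientAddGroup.eq_iff_sub_mem.mp htx)
      refine ⟨⟨x - t, hmem⟩, Set.mem_vadd_set.mpr ⟨t, ht, ?_⟩⟩
      rw [AddSubgroup.mk_vadd, vadd_eq_add, sub_add_cancel]
    · rintro ⟨g, hx⟩
      obtain ⟨t, ht, rfl⟩ := Set.mem_vadd_set.mp hx
      refine ⟨t, ht, ?_⟩
      rw [QuotientAddGroup.eq_iff_sub_mem, AddSubgroup.vadd_def, vadd_eq_add,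
        show t - ((g : ℝ) + t) = -(g : ℝ) by ring]
      exact AddSubgroup.neg_mem _ g.2
  rw [AddCircle.add_projection_respects_measure p 0 hUm]
  erw [hpre]
  rw [Set.iUnion_inter, measure_iUnion]
  · exact ((isAddFundamentalDomain_Ioc hp.out 0).measure_eq_tsum T).symm
  · -- the translates are pairwise disjoint, by injectivity on `T`
    intro g g' hne
    refine Set.disjoint_left.mpr fun x hx hx' => hne ?_
    obtain ⟨t, ht, htx⟩ := Set.mem_vadd_set.mp hx.1
    obtain ⟨t', ht', ht'x⟩ := Set.mem_vadd_set.mp hx'.1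
    rw [AddSubgroup.vadd_def, vadd_eq_add] at htx ht'x
    have htt' : ((t : ℝ) : AddCircle p) = ((t' : ℝ) : AddCircle p) := by
      rw [QuotientAddGroup.eq_iff_sub_mem]
      have : t - t' = (g' : ℝ) - g := by linarith
      rw [this]
      exact AddSubgroup.sub_mem _ g'.2 g.2
    have := hinj ht ht' htt'
    subst this
    exact Subtype.ext (by linarith)
  · intro g
    exact (hTm.const_vadd g).inter measurableSet_Ioc

/-! ## Prop. 5.7 (ii)(c) -/

/-- **[AbsTopIII] Prop. 5.7 (ii)(c), log-compatibility — DISCHARGE of the named fact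
`ExpLogVolumeCompatible`**: for `A ∈ M(k)` with `exp_k(A) ⊆ 𝒪_k^×` such that `pr_ℝ` and `exp_k` are
injective on `A`, `μ_k^log(A) = μ̆_k^log(exp_k(A))`. Indeed `A = i·T`, `pr_ℝ(A) = {|t|}` has length
`λ(T)` and the projection of `exp_k(A)` to `𝒪_k^× = ℝ/2πℤ` is `T mod 2π`, of arc length `λ(T)`
(the two lemmas above). [cite: MochizukiAbsTopIII2015, Prop 5.7 (ii)(c) p. 138] -/
theorem ExpLogVolumeCompatible_holds : ExpLogVolumeCompatible := by
  haveI : Fact (0 < 2 * Real.pi) := ⟨Real.two_pi_pos⟩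
  rintro A ⟨-, hcpt, -⟩ hsph hinjN hinjE
  -- real parts vanish on `A`: `A = i·T`, `T = im(A)`
  have hre : ∀ a ∈ A, a.re = 0 := fun a ha => by
    have h1 : ‖Complex.exp a‖ = 1 := mem_sphere_zero_iff_norm.mp (hsph ⟨a, ha, rfl⟩)
    rw [Complex.norm_exp] at h1
    exact Real.exp_eq_one_iff _ |>.mp h1
  have heq : ∀ a ∈ A, ((a.im : ℝ) : ℂ) * Complex.I = a := fun a ha => by
    conv_rhs => rw [← Complex.re_add_im a]
    rw [hre a ha, Complex.ofReal_zero, zero_add]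
  have hnorm : ∀ a ∈ A, ‖a‖ = |a.im| := fun a ha => by
    conv_lhs => rw [← heq a ha]
    rw [norm_mul, Complex.norm_I, mul_one, Complex.norm_real, Real.norm_eq_abs]
  have hphase : ∀ a ∈ A, phase (Complex.exp a) = ((a.im : ℝ) : AddCircle (2 * Real.pi)) :=
    fun a ha => by
    conv_lhs => rw [← heq a ha]
    rw [phase, Complex.arg_exp_mul_I, ← self_sub_toIocDiv_zsmul, AddCircle.coe_sub,
      AddCircle.coe_zsmul, AddCircle.coe_period, smul_zero, sub_zero]
  set T : Set ℝ := Complex.im '' A with hT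
  have hTc : IsCompact T := hcpt.image Complex.continuous_im
  -- the two projections as images of `T`
  have hrad : ((fun z : ℂ => ‖z‖) '' A : Set ℝ) = (fun t : ℝ => |t|) '' T := by
    rw [hT, Set.image_image]
    exact Set.image_congr fun a ha => hnorm a ha
  have hang : phase '' (Complex.exp '' A) = ((↑) : ℝ → AddCircle (2 * Real.pi)) '' T := by
    rw [hT, Set.image_image, Set.image_image]
    exact Set.image_congr fun a ha => hphase a ha
  -- the two injectivity hypotheses, transported to `T`
  have hinjT1 : InjOn (fun t : ℝ => |t|) T := by
    rintro _ ⟨a, ha, rfl⟩ _ ⟨b, hb, rfl⟩ h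
    have hab : a = b := hinjN ha hb (show ‖a‖ = ‖b‖ by rw [hnorm a ha, hnorm b hb]; exact h)
    rw [hab]
  have hinjT2 : InjOn ((↑) : ℝ → AddCircle (2 * Real.pi)) T := by
    rintro _ ⟨a, ha, rfl⟩ _ ⟨b, hb, rfl⟩ h
    have h' : ((a.im - b.im : ℝ) : AddCircle (2 * Real.pi)) = 0 := by
      rw [AddCircle.coe_sub]; exact sub_eq_zero.mpr h
    obtain ⟨n, hn⟩ := (AddCircle.coe_eq_zero_iff (2 * Real.pi)).mp h'
    have hab : Complex.exp a = Complex.exp b := by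
      rw [← heq a ha, ← heq b hb, Complex.exp_eq_exp_iff_exists_int]
      refine ⟨n, ?_⟩
      have him : a.im = b.im + n * (2 * Real.pi) := by rw [zsmul_eq_mul] at hn; linarith
      rw [him]
      push_cast
      ring
    rw [hinjE ha hb hab]
  -- conclusion
  unfold radialLogVolume angularLogVolume radialVolume angularVolume
  rw [hrad, hang, volume_image_abs_of_injOn hTc.isClosed.measurableSet hinjT1,
    volume_image_coe_addCircle_of_injOn hTc hinjT2]

end ComplexVolume

end Literature.AnabelianGeometry.AbsoluteAnabelian

end
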